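import Mathlib
import Summits.ValiantsHypothesis.ValiantsHypothesis.Theses.LacunarySymmetroid
import Summits.ValiantsHypothesis.ValiantsHypothesis.Theorems.LacunarySymmetroidPencilTransfer
import Summits.ValiantsHypothesis.ValiantsHypothesis.Theorems.LacunarySymmetroidThetaWitness
import Summits.ValiantsHypothesis.ValiantsHypothesis.Theorems.LacunarySymmetroidMatrixDescartesHyperbolicThetaWitness
import Summits.ValiantsHypothesis.ValiantsHypothesis.Theorems.LacunarySymmetroidMatrixDescartesCensusDefs
import Summits.ValiantsHypothesis.ValiantsHypothesis.Theorems.LacunarySymmetroidMatrixDescartesCensusFrame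
import Summits.ValiantsHypothesis.ValiantsHypothesis.Theorems.LacunarySymmetroidMatrixDescartesCensusKLawBridge
import Summits.ValiantsHypothesis.ValiantsHypothesis.Theorems.LacunarySymmetroidMatrixDescartesStubArith4

/-!
# LINE «amplify» — WITNESS AMPLIFICATION ⇒ the `O(K·log K) + polylog(m)` DOOR
(val-idea-6 g2, lens «assume the law fails ⇒ structure of a super-polynomial family ⇒ what VNP-hardness needs»)

Target decl BY NAME: `_root_.ValiantsHypothesis`, through the V1 door of route `LacunarySymmetroid`
(bears_on: stmt-ValiantsHypothesis-18050 `MatrixDescartes`; Conjecture B `KPlusLogSqLaw`).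

**Assume the law fails NARROWLY.**  The standing fork of the cell (STRUCTURE §4 N18, K1-PENCILTRANSFER-ANSWER §2)
is: if tropical designs are asymptotically Descartes-sharp on the square tower `m = K²` («T_∞»), then
`log₂ ζ(K²,K) ≈ (K−2)·log₂K + 1.44·K`, which refutes `MatrixDescartes` (it demands `q·log₂ Z ≤ K⌊log₂K⌋` for EVERY
`q`, and `q = 2` already fails there) — while Descartes alone can never decide it.  A super-polynomial family of this
kind has `log₂ Z = Θ(K log K)`: it beats the door's threshold by a CONSTANT FACTOR in the exponent, nothing more.

**What VNP-hardness actually needs.**  The threshold `2^{K⌊log₂K⌋}` is an artefact of the witness normalisation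
(`ThetaWitness`: `2^{n⌊log₂n⌋} − 1` roots with `K = n+1` terms, base-`2^{2L+3}` digits).  The witness side is
TUNABLE: Tavenas' family `h_ν` with base-`2^{2aL+3}` digits (`ν = a·n·L`, the tree's `exists_digitSubst` is already
parametric in `β`) is a VNP family `Θ^{(a)}_n` in `n` variables whose restriction to `y_i = X^{2^{βi}}` is
`tavenasV (a n L)`: `2^{a·n⌊log₂n⌋} − 1` distinct (real, simple) roots, for EVERY `a : ℕ`, still with `K = n + 1`
terms and quasi-polynomial size.  Hence the door needs only

  `LinLogLaw A` for SOME `A`:  on qp formats, `Z(det F) ≤ 2^{A·K⌊log₂K⌋}`  — «O(K log K), not o(K log K)».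

Consequences (all kernel-checked below unless marked stub):
* `MatrixDescartes → LinLogLaw 1` (q = 1): the crux `∃ A, LinLogLaw A` is WEAKER than stmt-18050;
  `KPlusLogSqLaw → ∃ A, LinLogLaw A` via the tree bridge.
* THE N18 FORK IS RELOCATED, NOT DISSOLVED (critics crit-1/crit-2, 2026-08-28T01:4xZ, accepted): on every FIXED
  polynomial tower `m ≤ K^t` the law is a THEOREM with `A = 2t+4`, by Descartes alone (`linLogLawOnTower_descartes`,
  from the tree's `Census.realRootLawAt_descartes`), so full Descartes-sharpness of designs at `m = K²` (T_∞, the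
  printed N18 fear) — or on any FINITE set of towers, or up to constant factors — is CONSISTENT with the amplified
  door.  But the door needs ONE `A`, uniform over the qp window, and the window `c = t+2` already contains every tower
  `m = K^t`; Descartes allows `log₂ Z(K^t,K) ≈ (t−1)·K·log₂K` there, so a DEGREE-AGNOSTIC sharp-tower mechanism
  (rate `≥ ε·t·K log₂K` on the tower `K^t` for every `t`) refutes `∃ A, LinLogLaw A` at `t = A + 2`
  (`not_exists_linLogLaw_of_towerSharp`, typed below).  Content of A3 = «the tower-sharpness rate
  s_t := limsup_K log₂ζ(K^t,K)/(K log₂K) is BOUNDED in t» (+ the super-polynomial window); the fork moved from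
  «is the square tower extremal?» to «is s_t unbounded?» (s_t ≤ t−1 by Descartes; every known family has s_t → 0).
  The tree's negative doors `MatrixDescartes_false_of_TropicalMonster` (fixed `q ≥ 1`) and
  `matrixDescartes_qFour_false_of_RVPMonster` refute MDR but NOT `∃ A, LinLogLaw A`: a monster must now beat
  `2^{A·K·log K}` for EVERY `A` (`not_linLogLaw_of_rvpMonsterPow` records the exact rate needed).
* Census currency: ANY law `ζ(m,K) ≤ 2^{C(K⌊log₂K⌋ + ⌊log₂m⌋^p)}` (additive polylog(m) of ANY degree p) implies
  `LinLogLaw (C+1)` (`linLogLaw_of_linLogPolylogLaw`, absorption by the tree's `StubArith4.exp_le`); Conjecture B is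
  the case `(K, p) = (K, 2)` with `K` in place of `K log K` — far stronger than the door needs.
* Combination with LINE «hyperbolic» (same seat): the amplified witnesses are `tavenasV ν`, real-rooted and simple, so
  the weakest door of record is `∃ A, HypLinLogLaw A` (the law on the real-rooted-simple sector with an arbitrary
  constant); its glue `valiant_of_hypLinLogLaw` is the `P := IsRealRootedSimple` instance of the sector-generic glue.

Items (D-0145): A3 `∃ A, LinLogLaw A` (crux, the ONLY stub — a LAW: 0 provers by the standing rule) · A2
`∀ a, ThetaWitnessPow a` (PROVED `thetaWitnessPow_proof`: re-run of `thetaWitness_proof` with `β = 2aL+3`, `ν = anL`) ·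
A1 `DetTransfer` (PROVED, det-exact symmetric transfer from the tree's PencilTransfer lemmas) · glue `valiant_of_linLogLaw` (PROVED) ·
`linLogLaw_of_matrixDescartes` (PROVED) · rung `linLogLawOnTower_descartes` (PROVED) · `linLogLaw_of_linLogPolylogLaw`
(PROVED) · negative edge `not_linLogLaw_of_rvpMonsterPow` (PROVED).
VP ≠ VNP is not moved by this line: it lowers the bar the open law must clear, nothing more.
-/

set_option linter.dupNamespace false
set_option maxHeartbeats 800000

noncomputable section

namespace Summit.ValiantsHypothesis.ValiantsHypothesis.Theses.LacunarySymmetroid.AmplifyLine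

open scoped BigOperators Polynomial
open Summit.ValiantsHypothesis.ValiantsHypothesis.Theses.LacunarySymmetroid
  (MatrixDescartes PencilTransfer ThetaWitness)
open Summit.ValiantsHypothesis.ValiantsHypothesis.Theorems.LacunarySymmetroidMatrixDescartes
  (RealRootLawAt KPlusLogSqLaw)
open Literature.Computability.AlgebraicComplexity

/-- The lacunary symmetric pencil `F_{d,S}(X) = Σ_l X^{d l} S_l` (census currency). -/
abbrev pencil {m K : ℕ} (d : Fin K → ℕ) (S : Fin K → Matrix (Fin m) (Fin m) ℝ) :
    Matrix (Fin m) (Fin m) ℝ[X] :=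
  ∑ l, ((Polynomial.X : ℝ[X]) ^ d l) • (S l).map Polynomial.C

/-! ## The statements -/

/-- **A3 — the amplified door law with constant `A`** («O(K log K)»): on quasi-polynomial formats a real symmetric
lacunary `K`-term pencil has at most `2^{A·K⌊log₂K⌋}` distinct real roots of its determinant.
`MatrixDescartes` is (equivalent to) `∀ q, LinLogLaw (1/q)`; the door needs `LinLogLaw A` for ONE `A`. -/
def LinLogLaw (A : ℕ) : Prop :=
  ∀ c : ℕ, ∃ K₀ : ℕ, ∀ K m : ℕ, K₀ ≤ K → m ≤ 2 ^ ((Nat.log 2 K + c) ^ c) →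
    ∀ (d : Fin K → ℕ) (S : Fin K → Matrix (Fin m) (Fin m) ℝ), (∀ l, (S l).IsSymm) →
      (pencil d S).det.roots.toFinset.card ≤ 2 ^ (A * (K * Nat.log 2 K))

/-- **A2 — the amplified theta witness at rate `a`**: a real family `Θ_n` in `n` variables with VNP
complexification and exponents `d_n` such that eventually `Θ_n(X^{d_n})` has `≥ 2^{a·n⌊log₂n⌋} − 1` distinct real
roots.  `ThetaWitness = ThetaWitnessPow 1` (tree, PROVED); every `a` is reached by base-`2^{2a⌊log₂n⌋+3}` digits. -/
def ThetaWitnessPow (a : ℕ) : Prop :=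
  ∃ (Θ : ∀ n : ℕ, MvPolynomial (Fin n) ℝ) (d : ∀ n : ℕ, Fin n → ℕ),
    IsVNPFamily (fun n => MvPolynomial.map (algebraMap ℝ ℂ) (Θ n)) ∧
      ∃ n₀ : ℕ, ∀ n : ℕ, n₀ ≤ n →
        2 ^ (a * (n * Nat.log 2 n)) ≤
          (MvPolynomial.aeval (fun i => (Polynomial.X : ℝ[X]) ^ d n i) (Θ n)).roots.toFinset.card + 1

/-- **A1 — det-exact symmetric transfer** (`PencilTransfer` with equality of POLYNOMIALS; proved below). -/
def DetTransfer : Prop :=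
  ∀ (v : ℕ → ℕ) (f : ∀ n, MvPolynomial (Fin (v n)) ℝ),
    IsVPFamily (fun n => MvPolynomial.map (algebraMap ℝ ℂ) (f n)) →
    ∀ d : (n : ℕ) → Fin (v n) → ℕ, ∃ c : ℕ, ∀ n : ℕ, ∃ m : ℕ, m ≤ 2 ^ ((Nat.log 2 n + c) ^ c) ∧
      ∃ S : Fin (v n + 1) → Matrix (Fin m) (Fin m) ℝ, (∀ l, (S l).IsSymm) ∧
        (pencil (Fin.cons (α := fun _ => ℕ) (0 : ℕ) (d n)) S).det =
          MvPolynomial.aeval (fun i => (Polynomial.X : ℝ[X]) ^ d n i) (f n)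

/-- Sector version of the law: restricted to pencils whose determinant satisfies `P`. -/
def SectorLinLogLaw (P : ℝ[X] → Prop) (A : ℕ) : Prop :=
  ∀ c : ℕ, ∃ K₀ : ℕ, ∀ K m : ℕ, K₀ ≤ K → m ≤ 2 ^ ((Nat.log 2 K + c) ^ c) →
    ∀ (d : Fin K → ℕ) (S : Fin K → Matrix (Fin m) (Fin m) ℝ), (∀ l, (S l).IsSymm) →
      P (pencil d S).det → (pencil d S).det.roots.toFinset.card ≤ 2 ^ (A * (K * Nat.log 2 K))

/-- Sector version of the amplified witness: the restriction also satisfies `P`. -/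
def SectorWitnessPow (P : ℝ[X] → Prop) (a : ℕ) : Prop :=
  ∃ (Θ : ∀ n : ℕ, MvPolynomial (Fin n) ℝ) (d : ∀ n : ℕ, Fin n → ℕ),
    IsVNPFamily (fun n => MvPolynomial.map (algebraMap ℝ ℂ) (Θ n)) ∧
      ∃ n₀ : ℕ, ∀ n : ℕ, n₀ ≤ n →
        P (MvPolynomial.aeval (fun i => (Polynomial.X : ℝ[X]) ^ d n i) (Θ n)) ∧
        2 ^ (a * (n * Nat.log 2 n)) ≤
          (MvPolynomial.aeval (fun i => (Polynomial.X : ℝ[X]) ^ d n i) (Θ n)).roots.toFinset.card + 1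

/-! ## Obligation (the one stub) -/

/-- OBLIGATION A3 (THE CRUX of the line and its ONLY stub; a format-level LAW — weaker than `MatrixDescartes`, see
`linLogLaw_of_matrixDescartes`; a theorem on every polynomial tower, see `linLogLawOnTower_descartes`). -/
theorem stub_linLogLaw : ∃ A : ℕ, LinLogLaw A := by
  sorry

/-! ## A2 PROVED: the amplified witness at every rate (Tavenas' family, digit base `2^{2a⌊log₂n⌋+3}`) -/

section AmplifiedWitness

open MvPolynomial
open Summit.ValiantsHypothesis.ValiantsHypothesis.Theorems.SymmetroidDescartes
  (isProjection_map complexity_pow_le totalDegree_aeval_le_mul eval_map_tavenas_h)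
open Summit.ValiantsHypothesis.ValiantsHypothesis.Theorems.FeketeSOSSOSMagnification
  (isVNPFamily_of_levelwise' boolSum_aeval_sumElim)
open Summit.ValiantsHypothesis.ValiantsHypothesis.Theorems.LacunarySymmetroid
  (isVNPFamily_aeval_of_isPBounded isVNPFamily_map_of_isProjection_perPoly exists_digitSubst)

/-- **Master witness at rate `a` (PROVED in v2 of this workfile; LANDED in Theorems by val-width-18050-hw1 as
`Hyperbolic.exists_thetaPow`, p595331 — cited by name since v5)**: Tavenas' `h_ν` with `ν = a·n⌊log₂n⌋` under the digit substitution with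
`β = 2a⌊log₂n⌋ + 3`, `d_{n,i} = 2^{βi}`, is a real family with VNP complexification whose restriction to the monomial
curve IS `tavenasV (a·n⌊log₂n⌋)` (as a polynomial) for every `n ≥ 1`.  Verbatim re-run of the tree's `thetaWitness_proof`
with the base as a parameter; the only `a`-dependence is the p-bounded degree/cost `2^β ≤ 8 n^{2a} + 8`. -/
theorem masterWitness (a : ℕ) :
    ∃ (Θ : ∀ n : ℕ, MvPolynomial (Fin n) ℝ) (d : ∀ n : ℕ, Fin n → ℕ),
      IsVNPFamily (fun n => MvPolynomial.map (algebraMap ℝ ℂ) (Θ n)) ∧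
        ∀ n : ℕ, 1 ≤ n →
          MvPolynomial.aeval (fun i => (Polynomial.X : ℝ[X]) ^ d n i) (Θ n) =
            (tavenasV (a * (n * Nat.log 2 n))).map (Int.castRingHom ℝ) :=
  Summit.ValiantsHypothesis.ValiantsHypothesis.Theorems.LacunarySymmetroidMatrixDescartes.Hyperbolic.exists_thetaPow a

/-- The master restriction is real-rooted with simple roots and has `2^{a n ⌊log₂n⌋} − 1` of them. -/
theorem card_roots_master (ν : ℕ) :
    ((tavenasV ν).map (Int.castRingHom ℝ)).roots.toFinset.card = 2 ^ ν - 1 :=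
  card_roots_toFinset_map_tavenasV ν

theorem natDegree_map_tavenasV_le (ν : ℕ) : ((tavenasV ν).map (Int.castRingHom ℝ)).natDegree ≤ 2 ^ ν - 1 := by
  have := natDegree_tavenasV_lt ν
  exact (Polynomial.natDegree_map_le).trans (by omega)

/-- **A2 PROVED — the amplified theta witness at every rate `a`.** -/
theorem thetaWitnessPow_proof (a : ℕ) : ThetaWitnessPow a := by
  obtain ⟨Θ, d, hV, hres⟩ := masterWitness a
  refine ⟨Θ, d, hV, 1, fun n hn => ?_⟩
  rw [hres n hn, card_roots_master]
  have h1 : 1 ≤ 2 ^ (a * (n * Nat.log 2 n)) := Nat.one_le_two_pow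
  omega

end AmplifiedWitness

/-- A2 in the `∀ a` form consumed by the glue (PROVED). -/
theorem amplifiedThetaWitness : ∀ a : ℕ, ThetaWitnessPow a := thetaWitnessPow_proof

/-! ## A1 proved: det-exact transfer (the tree's «descend, don't realify» chain) -/

theorem detTransfer_proof : DetTransfer := by
  intro v f hf d
  obtain ⟨⟨c₀, hc₀⟩, hrep⟩ :=
    Summit.ValiantsHypothesis.ValiantsHypothesis.Theorems.LacunarySymmetroid.symmAffineRepr_of_isVPFamily_complex
      v f hf
  refine ⟨c₀ + 11, fun n => ?_⟩
  obtain ⟨B, hsymm, hB⟩ := hrep n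
  refine ⟨4 * determinantalComplexity (f n) ^ 3 + 7,
    Summit.ValiantsHypothesis.ValiantsHypothesis.Theorems.LacunarySymmetroid.pencilTransfer_size_bound (hc₀ n),
    Fin.cons (α := fun _ => Matrix (Fin (4 * determinantalComplexity (f n) ^ 3 + 7))
      (Fin (4 * determinantalComplexity (f n) ^ 3 + 7)) ℝ) (constPart B) (fun i => LRPencil.coeffMat B i),
    ?_, ?_⟩
  · refine Fin.cases ?_ (fun i => ?_)
    · rw [Fin.cons_zero]; exact hsymm.map _
    · rw [Fin.cons_succ]; exact hsymm.map _
  · rw [Summit.ValiantsHypothesis.ValiantsHypothesis.Theorems.LacunarySymmetroid.pencilDet_of_affine B hB.1 (d n),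
      hB.2]

/-! ## Easy edges -/

/-- `MatrixDescartes → LinLogLaw 1` (instantiate `q = 1`): the crux is WEAKER than stmt-18050. -/
theorem linLogLaw_of_matrixDescartes (h : MatrixDescartes) : LinLogLaw 1 := by
  intro c
  obtain ⟨K₀, hK⟩ := h c 1 (by norm_num)
  refine ⟨K₀, fun K m hK₀ hm d S hS => ?_⟩
  have h1 := hK K m hK₀ hm d S hS
  rw [pow_one] at h1
  rw [one_mul]
  exact h1

/-- Conjecture B implies the crux (through the tree bridge `Census.matrixDescartes_of_kPlusLogSqLaw`). -/
theorem linLogLaw_of_kPlusLogSqLaw (h : KPlusLogSqLaw) : ∃ A, LinLogLaw A :=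
  ⟨1, linLogLaw_of_matrixDescartes
    (Summit.ValiantsHypothesis.ValiantsHypothesis.Theorems.LacunarySymmetroidMatrixDescartes.Census.matrixDescartes_of_kPlusLogSqLaw
      h)⟩

/-- Monotonicity in the constant. -/
theorem linLogLaw_mono {A A' : ℕ} (hAA' : A ≤ A') (h : LinLogLaw A) : LinLogLaw A' := by
  intro c
  obtain ⟨K₀, hK⟩ := h c
  refine ⟨K₀, fun K m hK₀ hm d S hS => (hK K m hK₀ hm d S hS).trans ?_⟩
  exact Nat.pow_le_pow_right (by norm_num) (Nat.mul_le_mul_right _ hAA')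

/-- The law restricts to every sector. -/
theorem sectorLinLogLaw_of_linLogLaw (P : ℝ[X] → Prop) {A : ℕ} (h : LinLogLaw A) : SectorLinLogLaw P A := by
  intro c
  obtain ⟨K₀, hK⟩ := h c
  exact ⟨K₀, fun K m hK₀ hm d S hS _ => hK K m hK₀ hm d S hS⟩

/-- A witness is a witness for the trivial sector. -/
theorem sectorWitnessPow_top_of_thetaWitnessPow {a : ℕ} (h : ThetaWitnessPow a) :
    SectorWitnessPow (fun _ => True) a := by
  obtain ⟨Θ, d, hV, n₀, hw⟩ := h
  exact ⟨Θ, d, hV, n₀, fun n hn => ⟨trivial, hw n hn⟩⟩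

/-- `ThetaWitness` (tree, PROVED `thetaWitness_proof`) is the rate-1 witness. -/
theorem thetaWitnessPow_one_of_thetaWitness (h : ThetaWitness) : ThetaWitnessPow 1 := by
  obtain ⟨Θ, d, hV, n₀, hw⟩ := h
  refine ⟨Θ, d, hV, n₀, fun n hn => ?_⟩
  rw [one_mul]
  exact hw n hn

theorem thetaWitnessPow_one : ThetaWitnessPow 1 :=
  thetaWitnessPow_one_of_thetaWitness
    Summit.ValiantsHypothesis.ValiantsHypothesis.Theorems.LacunarySymmetroid.thetaWitness_proof

/-! ## The core: a VP family with `2^{(2A+1)·n⌊log₂n⌋}` roots contradicts the law with constant `A` -/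

/-- **Core lemma.**  A real VP family (in the sector `P`) whose lacunary restriction has eventually
`≥ 2^{(2A+1)·n⌊log₂n⌋} − 1` distinct real roots is incompatible with `SectorLinLogLaw P A`:
push it through the det-exact transfer (`K = n+1`, `m ≤ 2^((⌊log₂n⌋+c)^c)`) and compare exponents
(`(2A+1)·nL ≤ A(n+1)(L+1) + 1 ≤ 2A·nL + 1` is absurd for `n ≥ 4`). -/
theorem false_of_vpFamily (P : ℝ[X] → Prop) (A : ℕ) (hlaw : SectorLinLogLaw P A)
    (Θ : ∀ n : ℕ, MvPolynomial (Fin n) ℝ) (d : ∀ n : ℕ, Fin n → ℕ)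
    (hVP : IsVPFamily (fun n => MvPolynomial.map (algebraMap ℝ ℂ) (Θ n))) (n₀ : ℕ)
    (hw : ∀ n : ℕ, n₀ ≤ n →
      P (MvPolynomial.aeval (fun i => (Polynomial.X : ℝ[X]) ^ d n i) (Θ n)) ∧
      2 ^ ((2 * A + 1) * (n * Nat.log 2 n)) ≤
        (MvPolynomial.aeval (fun i => (Polynomial.X : ℝ[X]) ^ d n i) (Θ n)).roots.toFinset.card + 1) :
    False := by
  obtain ⟨c, hc⟩ := detTransfer_proof (fun n => n) Θ hVP d
  obtain ⟨K₀, hK⟩ := hlaw c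
  obtain ⟨n, hn₀, hnK, hn4⟩ : ∃ n, n₀ ≤ n ∧ K₀ ≤ n ∧ 4 ≤ n := ⟨n₀ + K₀ + 4, by omega, by omega, by omega⟩
  obtain ⟨m, hm, S, hS, hdet⟩ := hc n
  obtain ⟨hP, h2⟩ := hw n hn₀
  set Z := (MvPolynomial.aeval (fun i => (Polynomial.X : ℝ[X]) ^ d n i) (Θ n)).roots.toFinset.card with hZ
  have hm' : m ≤ 2 ^ ((Nat.log 2 (n + 1) + c) ^ c) :=
    hm.trans (Nat.pow_le_pow_right (by norm_num)
      (Nat.pow_le_pow_left (Nat.add_le_add_right (Nat.log_mono_right (Nat.le_succ n)) c) c))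
  have hP' : P (pencil (Fin.cons (α := fun _ => ℕ) (0 : ℕ) (d n)) S).det := by rw [hdet]; exact hP
  have h1 := hK (n + 1) m (by omega) hm' (Fin.cons (α := fun _ => ℕ) (0 : ℕ) (d n)) S hS hP'
  rw [hdet] at h1
  set L := Nat.log 2 n with hL
  have hL2 : 2 ≤ L := by
    rw [hL]
    calc 2 = Nat.log 2 4 := by decide
      _ ≤ Nat.log 2 n := Nat.log_mono_right hn4
  have hL' : Nat.log 2 (n + 1) ≤ L + 1 := by
    rw [hL]
    calc Nat.log 2 (n + 1) ≤ Nat.log 2 (n * 2) := Nat.log_mono_right (by omega)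
      _ = Nat.log 2 n + 1 := Nat.log_mul_base (by norm_num) (by omega)
  have h3 : Z ≤ 2 ^ (A * ((n + 1) * (L + 1))) :=
    h1.trans (Nat.pow_le_pow_right (by norm_num) (Nat.mul_le_mul_left _ (Nat.mul_le_mul_left _ hL')))
  have h4 : 2 ^ ((2 * A + 1) * (n * L)) ≤ 2 ^ (A * ((n + 1) * (L + 1)) + 1) := by
    have h1' : 1 ≤ 2 ^ (A * ((n + 1) * (L + 1))) := Nat.one_le_two_pow
    calc 2 ^ ((2 * A + 1) * (n * L)) ≤ Z + 1 := h2
      _ ≤ 2 ^ (A * ((n + 1) * (L + 1))) + 2 ^ (A * ((n + 1) * (L + 1))) := by omega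
      _ = 2 ^ (A * ((n + 1) * (L + 1)) + 1) := by rw [pow_succ]; ring
  have h5 : (2 * A + 1) * (n * L) ≤ A * ((n + 1) * (L + 1)) + 1 :=
    (Nat.pow_le_pow_iff_right (by norm_num)).1 h4
  have hsum : (n + 1) * (L + 1) ≤ 2 * (n * L) := by nlinarith
  have h6 : A * ((n + 1) * (L + 1)) ≤ 2 * (A * (n * L)) := by
    calc A * ((n + 1) * (L + 1)) ≤ A * (2 * (n * L)) := Nat.mul_le_mul_left _ hsum
      _ = 2 * (A * (n * L)) := by ring
  have h7 : (2 * A + 1) * (n * L) = 2 * (A * (n * L)) + n * L := by ring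
  have h8 : 8 ≤ n * L := by nlinarith
  rw [h7] at h5
  generalize hQ : A * (n * L) = Q at h5 h6
  generalize hP0 : n * L = P0 at h5 h8
  omega

/-- **Sector-generic deciding glue**: `(∃ A, SectorLinLogLaw P A) → (∀ a, SectorWitnessPow P a) → VH`. -/
theorem valiant_of_sectorLinLogLaw (P : ℝ[X] → Prop) (hlaw : ∃ A, SectorLinLogLaw P A)
    (hW : ∀ a, SectorWitnessPow P a) : _root_.ValiantsHypothesis := by
  show Literature.Computability.AlgebraicComplexity.VP ℂ ≠ Literature.Computability.AlgebraicComplexity.VNP ℂ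
  intro hEq
  obtain ⟨A, hA⟩ := hlaw
  obtain ⟨Θ, d, hVNP, n₀, hw⟩ := hW (2 * A + 1)
  have hVP : IsVPFamily (fun n => MvPolynomial.map (algebraMap ℝ ℂ) (Θ n)) := by
    have hmem := (mem_VNP_ofFintype_iff_holds _).2 hVNP
    rw [← hEq] at hmem
    exact (mem_VP_ofFintype_iff_holds _).1 hmem
  exact false_of_vpFamily P A hA Θ d hVP n₀ hw

/-- **THE DECIDING GLUE of the line (kernel-checked)**: `(∃ A, LinLogLaw A) → (∀ a, ThetaWitnessPow a) → VH`
(the det-exact transfer A1 is consumed PROVED, not as a hypothesis). -/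
theorem valiant_of_linLogLaw (hlaw : ∃ A, LinLogLaw A) (hW : ∀ a, ThetaWitnessPow a) :
    _root_.ValiantsHypothesis := by
  obtain ⟨A, hA⟩ := hlaw
  exact valiant_of_sectorLinLogLaw (fun _ => True) ⟨A, sectorLinLogLaw_of_linLogLaw _ hA⟩
    fun a => sectorWitnessPow_top_of_thetaWitnessPow (hW a)

/-- **Composition to the EXISTING target by name**: the law stub A3 + the PROVED amplified witness A2 give `ValiantsHypothesis`. -/
theorem valiantsHypothesis_of_stubs : _root_.ValiantsHypothesis :=
  valiant_of_linLogLaw stub_linLogLaw amplifiedThetaWitness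

/-! ## Negative edge: the exact rate a monster must now reach -/

/-- A real VP monster at rate `a` (the tree's `RVPMonster` is the case `a = 1`). -/
def RVPMonsterPow (a : ℕ) : Prop :=
  ∃ (Θ : ∀ n : ℕ, MvPolynomial (Fin n) ℝ) (d : ∀ n : ℕ, Fin n → ℕ),
    IsVPFamily (fun n => MvPolynomial.map (algebraMap ℝ ℂ) (Θ n)) ∧
      ∃ n₀ : ℕ, ∀ n : ℕ, n₀ ≤ n →
        2 ^ (a * (n * Nat.log 2 n)) ≤
          (MvPolynomial.aeval (fun i => (Polynomial.X : ℝ[X]) ^ d n i) (Θ n)).roots.toFinset.card + 1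

/-- A rate-`(2A+1)` real VP monster refutes `LinLogLaw A` (so refuting the crux `∃ A, LinLogLaw A` needs monsters of
EVERY rate — the tree's fixed-rate doors `MatrixDescartes_false_of_TropicalMonster` /
`matrixDescartes_qFour_false_of_RVPMonster` do not reach it). -/
theorem not_linLogLaw_of_rvpMonsterPow (A : ℕ) (hM : RVPMonsterPow (2 * A + 1)) : ¬ LinLogLaw A := by
  intro hA
  obtain ⟨Θ, d, hVP, n₀, hw⟩ := hM
  exact false_of_vpFamily (fun _ => True) A (sectorLinLogLaw_of_linLogLaw _ hA) Θ d hVP n₀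
    fun n hn => ⟨trivial, hw n hn⟩

/-! ## The rung: on every FIXED polynomial tower the law is a theorem (Descartes) — the N18 fork is relocated to `t → ∞` -/

/-- The law on the polynomial tower `m ≤ K^t` with constant `A` (no `c`, threshold `K ≥ 2`). -/
def LinLogLawOnTower (t A : ℕ) : Prop :=
  ∀ K m : ℕ, 2 ≤ K → m ≤ K ^ t →
    ∀ (d : Fin K → ℕ) (S : Fin K → Matrix (Fin m) (Fin m) ℝ), (∀ l, (S l).IsSymm) →
      (pencil d S).det.roots.toFinset.card ≤ 2 ^ (A * (K * Nat.log 2 K))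

/-- **Rung (PROVED).**  `LinLogLawOnTower t (2t+4)`: for `m ≤ K^t`, Descartes' bound
`Z ≤ 2·C(m+K−1,m) − 1 ≤ 2·(2K^{t+1})^K ≤ 2^{(2t+4)·K⌊log₂K⌋}`.  So even FULL Descartes-sharpness on any FIXED
polynomial tower (in particular T_∞ at `m = K²`), or on finitely many, is consistent with the amplified door; the
constant `2t+4` grows with `t`, and uniformity in `t` is exactly what A3 asserts (`not_exists_linLogLaw_of_towerSharp`). -/
theorem linLogLawOnTower_descartes (t : ℕ) : LinLogLawOnTower t (2 * t + 4) := by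
  intro K m hK hm d S hS
  have hD :=
    Summit.ValiantsHypothesis.ValiantsHypothesis.Theorems.LacunarySymmetroidMatrixDescartes.Census.realRootLawAt_descartes
      m K (by omega) d S hS
  have e : m + K - 1 = m + (K - 1) := by omega
  have hc : Nat.choose (m + K - 1) m ≤ (m + (K - 1)) ^ (K - 1) := by
    rw [e, Nat.choose_symm_add]
    exact Nat.choose_le_pow _ _
  have hKt : K ≤ K ^ (t + 1) := by
    calc K = K ^ 1 := (pow_one K).symm
      _ ≤ K ^ (t + 1) := Nat.pow_le_pow_right (by omega) (by omega)
  have hmt : m ≤ K ^ (t + 1) := hm.trans (Nat.pow_le_pow_right (by omega) (by omega))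
  have hbase : m + (K - 1) ≤ 2 * K ^ (t + 1) := by omega
  set L := Nat.log 2 K with hL
  have hKL : K ≤ 2 ^ (L + 1) := (Nat.lt_pow_succ_log_self one_lt_two K).le
  have hL1 : 1 ≤ L := by
    rw [hL]
    exact Nat.le_log_of_pow_le one_lt_two (by simpa using hK)
  have hpow : (m + (K - 1)) ^ (K - 1) ≤ 2 ^ (K + (L + 1) * (t + 1) * K) := by
    calc (m + (K - 1)) ^ (K - 1) ≤ (2 * K ^ (t + 1)) ^ (K - 1) := Nat.pow_le_pow_left hbase _
      _ ≤ (2 * K ^ (t + 1)) ^ K := Nat.pow_le_pow_right (by positivity) (by omega)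
      _ = 2 ^ K * (K ^ (t + 1)) ^ K := by rw [mul_pow]
      _ ≤ 2 ^ K * ((2 ^ (L + 1)) ^ (t + 1)) ^ K :=
          Nat.mul_le_mul_left _ (Nat.pow_le_pow_left (Nat.pow_le_pow_left hKL _) _)
      _ = 2 ^ (K + (L + 1) * (t + 1) * K) := by
          rw [← pow_mul, ← pow_mul, ← pow_add, Nat.mul_assoc]
  have hkey : K + (L + 1) * (t + 1) * K + 1 ≤ (2 * t + 4) * (K * L) := by
    have h1 : (t + 3) * K * 1 ≤ (t + 3) * K * L := Nat.mul_le_mul_left _ hL1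
    nlinarith [h1, hK]
  have hZ : (pencil d S).det.roots.toFinset.card ≤ 2 * 2 ^ (K + (L + 1) * (t + 1) * K) := by
    have := hc.trans hpow
    change (pencil d S).det.roots.toFinset.card ≤ 2 * Nat.choose (m + K - 1) m - 1 at hD
    omega
  calc (pencil d S).det.roots.toFinset.card ≤ 2 * 2 ^ (K + (L + 1) * (t + 1) * K) := hZ
    _ = 2 ^ (K + (L + 1) * (t + 1) * K + 1) := by rw [pow_succ]; ring
    _ ≤ 2 ^ ((2 * t + 4) * (K * L)) := Nat.pow_le_pow_right (by norm_num) hkey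

/-- The tower rung in `LinLogLaw` clothing: restricted to the regime `m ≤ K^t` (instead of `m ≤ 2^((log K+c)^c)`) the
amplified law holds outright.  (For the record; the door's regime is the super-polynomial window.) -/
theorem linLogLaw_content_is_superpolynomial (t : ℕ) :
    ∀ K m : ℕ, 2 ≤ K → m ≤ K ^ t →
      ∀ (d : Fin K → ℕ) (S : Fin K → Matrix (Fin m) (Fin m) ℝ), (∀ l, (S l).IsSymm) →
        (pencil d S).det.roots.toFinset.card ≤ 2 ^ ((2 * t + 4) * (K * Nat.log 2 K)) :=
  linLogLawOnTower_descartes t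

/-! ## Negative edge II (critics' 0-width ask): sharpness on ALL towers with rate unbounded in `t` kills A3 -/

/-- **Tower-sharpness at rate `A` on the tower `m ≤ K^t`**: infinitely often in `K`, some real symmetric pencil of a
format on the tower has MORE than `2^{A·K⌊log₂K⌋}` real roots.  (By `linLogLawOnTower_descartes` this forces
`A < 2t+4`: `towerSharp_rate_lt`.) -/
def TowerSharp (t A : ℕ) : Prop :=
  ∀ K₀ : ℕ, ∃ K m : ℕ, K₀ ≤ K ∧ m ≤ K ^ t ∧
    ∃ (d : Fin K → ℕ) (S : Fin K → Matrix (Fin m) (Fin m) ℝ), (∀ l, (S l).IsSymm) ∧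
      2 ^ (A * (K * Nat.log 2 K)) < (pencil d S).det.roots.toFinset.card

/-- Every polynomial tower lies in a quasi-polynomial window: `K^t ≤ 2^{(⌊log₂K⌋ + (t+2))^{t+2}}`. -/
theorem tower_le_window (K t : ℕ) : K ^ t ≤ 2 ^ ((Nat.log 2 K + (t + 2)) ^ (t + 2)) := by
  set L := Nat.log 2 K with hL
  have hK : K < 2 ^ (L + 1) := Nat.lt_pow_succ_log_self (by norm_num) K
  have h1 : K ^ t ≤ (2 ^ (L + 1)) ^ t := Nat.pow_le_pow_left hK.le t
  rw [← pow_mul] at h1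
  refine h1.trans (Nat.pow_le_pow_right (by norm_num) ?_)
  have h2 : (L + 1) * t ≤ (L + (t + 2)) ^ 2 := by nlinarith
  exact h2.trans (Nat.pow_le_pow_right (by omega) (by omega))

/-- **The relocated fork, typed (PROVED).**  If for every rate `A` some tower is sharp at rate `A`
(i.e. the tower-sharpness rate is unbounded in `t`), then the amplified law fails for every constant. -/
theorem not_exists_linLogLaw_of_towerSharp (h : ∀ A : ℕ, ∃ t : ℕ, TowerSharp t A) : ¬ ∃ A, LinLogLaw A := by
  rintro ⟨A, hA⟩
  obtain ⟨t, ht⟩ := h A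
  obtain ⟨K₀, hK⟩ := hA (t + 2)
  obtain ⟨K, m, hK₀, hm, d, S, hS, hlt⟩ := ht K₀
  have hwin : m ≤ 2 ^ ((Nat.log 2 K + (t + 2)) ^ (t + 2)) := hm.trans (tower_le_window K t)
  exact absurd (hK K m hK₀ hwin d S hS) (not_le.mpr hlt)

/-- Conversely the rung bounds the rate on each fixed tower: sharpness at rate `A` on the tower `K^t` needs `A < 2t+4`. -/
theorem towerSharp_rate_lt {t A : ℕ} (h : TowerSharp t A) : A < 2 * t + 4 := by
  by_contra hA
  push_neg at hA
  obtain ⟨K, m, hK₀, hm, d, S, hS, hlt⟩ := h 2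
  have h1 := linLogLawOnTower_descartes t K m hK₀ hm d S hS
  have h2 : 2 ^ ((2 * t + 4) * (K * Nat.log 2 K)) ≤ 2 ^ (A * (K * Nat.log 2 K)) :=
    Nat.pow_le_pow_right (by norm_num) (Nat.mul_le_mul_right _ hA)
  omega

/-- **Uniform tower law at rate `A`**: on EVERY polynomial tower `m ≤ K^t`, eventually in `K`, `Z ≤ 2^{A·K⌊log₂K⌋}` —
ONE constant for all `t` (the threshold may depend on `t`).  The critics' reading of A3's content: «the tower-sharpness
rate is bounded in `t`». -/
def UniformTowerLaw (A : ℕ) : Prop :=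
  ∀ t : ℕ, ∃ K₀ : ℕ, ∀ K m : ℕ, K₀ ≤ K → m ≤ K ^ t →
    ∀ (d : Fin K → ℕ) (S : Fin K → Matrix (Fin m) (Fin m) ℝ), (∀ l, (S l).IsSymm) →
      (pencil d S).det.roots.toFinset.card ≤ 2 ^ (A * (K * Nat.log 2 K))

/-- A3 implies the uniform tower law with the same constant (towers sit inside windows, `tower_le_window`); the
converse is NOT claimed — A3 = uniform tower law + the super-polynomial window `K^{ω(1)} ≤ m ≤ 2^{polylog K}`. -/
theorem uniformTowerLaw_of_linLogLaw {A : ℕ} (h : LinLogLaw A) : UniformTowerLaw A := by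
  intro t
  obtain ⟨K₀, hK⟩ := h (t + 2)
  exact ⟨K₀, fun K m hK₀ hm d S hS => hK K m hK₀ (hm.trans (tower_le_window K t)) d S hS⟩

/-- The uniform tower law fails iff some rate is exceeded on some tower infinitely often — `TowerSharp` is its typed negation. -/
theorem not_uniformTowerLaw_iff (A : ℕ) : ¬ UniformTowerLaw A ↔ ∃ t, TowerSharp t A := by
  unfold UniformTowerLaw TowerSharp
  push_neg
  rfl

/-! ## Census currency: an additive polylog(m) term of ANY degree is free -/

/-- A census-shaped law with `K log K` growth and an additive polylog(m) term of degree `p`: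
`ζ(m,K) ≤ 2^{C(K⌊log₂K⌋ + ⌊log₂m⌋^p)}`.  (Conjecture B has `K` for `K⌊log₂K⌋` and `p = 2`.) -/
def LinLogPolylogLaw (C p : ℕ) : Prop :=
  ∀ m K : ℕ, RealRootLawAt m K (2 ^ (C * (K * Nat.log 2 K + Nat.log 2 m ^ p)))

/-- **Absorption (PROVED)**: `LinLogPolylogLaw C p → LinLogLaw (C+1)` for every `p ≥ 1` — in the qp regime
`⌊log₂m⌋^p ≤ (⌊log₂K⌋+c)^{cp}`, and `C·(⌊log₂K⌋+cp)^{cp} ≤ K⌊log₂K⌋` eventually (tree `StubArith4.exp_le`). -/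
theorem linLogLaw_of_linLogPolylogLaw (C p : ℕ) (hp : 1 ≤ p) (h : LinLogPolylogLaw C p) :
    LinLogLaw (C + 1) := by
  intro c
  obtain ⟨K₁, hK₁⟩ :=
    Summit.ValiantsHypothesis.ValiantsHypothesis.Theorems.LacunarySymmetroidMatrixDescartes.StubArith4.exp_le
      (c * p) C
  refine ⟨K₁, fun K m hK hm d S hS => ?_⟩
  have hZ := h m K d S hS
  have hlogm : Nat.log 2 m ≤ (Nat.log 2 K + c) ^ c :=
    calc Nat.log 2 m ≤ Nat.log 2 (2 ^ ((Nat.log 2 K + c) ^ c)) := Nat.log_mono_right hm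
      _ = (Nat.log 2 K + c) ^ c := Nat.log_pow one_lt_two _
  have hpoly : Nat.log 2 m ^ p ≤ (Nat.log 2 K + c * p) ^ (c * p) :=
    calc Nat.log 2 m ^ p ≤ ((Nat.log 2 K + c) ^ c) ^ p := Nat.pow_le_pow_left hlogm p
      _ = (Nat.log 2 K + c) ^ (c * p) := by rw [← pow_mul]
      _ ≤ (Nat.log 2 K + c * p) ^ (c * p) :=
          Nat.pow_le_pow_left (Nat.add_le_add_left (Nat.le_mul_of_pos_right c hp) _) _
  have h1 : C * (Nat.log 2 K + c * p) ^ (c * p) ≤ K * Nat.log 2 K := hK₁ K hK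
  have h2 : C * Nat.log 2 m ^ p ≤ K * Nat.log 2 K := (Nat.mul_le_mul_left _ hpoly).trans h1
  refine hZ.trans (Nat.pow_le_pow_right (by norm_num) ?_)
  have e1 : C * (K * Nat.log 2 K + Nat.log 2 m ^ p) = C * (K * Nat.log 2 K) + C * Nat.log 2 m ^ p := by ring
  have e2 : (C + 1) * (K * Nat.log 2 K) = C * (K * Nat.log 2 K) + K * Nat.log 2 K := by ring
  rw [e1, e2]
  omega

/-! ## Combination with LINE «hyperbolic»: the weakest door of record -/

/-- The real-rooted-simple sector (LINE «hyperbolic»): `p` has `natDegree p` distinct real roots. -/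
def IsRealRootedSimple (p : ℝ[X]) : Prop := p.roots.toFinset.card = p.natDegree

/-- The amplified law on the real-rooted-simple sector. -/
def HypLinLogLaw (A : ℕ) : Prop := SectorLinLogLaw IsRealRootedSimple A

/-- The amplified witness in the sector (S/M from `tavenasV`: dense, Hutchinson, all roots real and simple). -/
def HypWitnessPow (a : ℕ) : Prop := SectorWitnessPow IsRealRootedSimple a

/-- **Weakest door of record (PROVED glue)**: a law with an ARBITRARY constant in the exponent, demanded ONLY of
pencils whose determinant splits over `ℝ` with simple roots, decides Valiant's hypothesis. -/
theorem valiant_of_hypLinLogLaw (hlaw : ∃ A, HypLinLogLaw A) (hW : ∀ a, HypWitnessPow a) :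
    _root_.ValiantsHypothesis :=
  valiant_of_sectorLinLogLaw IsRealRootedSimple hlaw hW

theorem hypLinLogLaw_of_linLogLaw {A : ℕ} (h : LinLogLaw A) : HypLinLogLaw A :=
  sectorLinLogLaw_of_linLogLaw _ h

/-- `tavenasV ν` (over `ℝ`) lies in the real-rooted-simple sector: `2^ν − 1` distinct real roots = its degree. -/
theorem isRealRootedSimple_map_tavenasV (ν : ℕ) :
    IsRealRootedSimple ((tavenasV ν).map (Int.castRingHom ℝ)) := by
  unfold IsRealRootedSimple
  apply le_antisymm
  · exact (Multiset.toFinset_card_le _).trans (Polynomial.card_roots' _)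
  · rw [card_roots_master]
    exact natDegree_map_tavenasV_le ν

/-- **The amplified witness lies in the sector, at every rate (PROVED)** — this is also LINE «hyperbolic»'s H2 at `a = 1`. -/
theorem hypWitnessPow_proof (a : ℕ) : HypWitnessPow a := by
  obtain ⟨Θ, d, hV, hres⟩ := masterWitness a
  refine ⟨Θ, d, hV, 1, fun n hn => ?_⟩
  rw [hres n hn]
  refine ⟨isRealRootedSimple_map_tavenasV _, ?_⟩
  rw [card_roots_master]
  have h1 : 1 ≤ 2 ^ (a * (n * Nat.log 2 n)) := Nat.one_le_two_pow
  omega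

/-- **Weakest door of record, fully assembled (PROVED glue + PROVED witness)**: an `O(K log K)` law demanded only of
pencils whose determinant splits over `ℝ` with simple roots decides Valiant's hypothesis; the law is the ONLY open item. -/
theorem valiant_of_hypLinLogLaw' (hlaw : ∃ A, HypLinLogLaw A) : _root_.ValiantsHypothesis :=
  valiant_of_hypLinLogLaw hlaw hypWitnessPow_proof

end Summit.ValiantsHypothesis.ValiantsHypothesis.Theses.LacunarySymmetroid.AmplifyLine

end
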